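import Literature.NumberTheory.Automorphic.JacquetModule
import HarnessLib

/-!
# Exactness of the Jacquet functor (Bernstein–Zelevinsky 1976, Prop. 2.35): the proof

Sibling proof file of `Literature.NumberTheory.Automorphic.JacquetModule` (the sibling
`JacquetModuleProofs` discharges `deltaChar_borel_gl_two`), discharging the named fact
`Representation.jacquet_exact`: for a parabolic triple `t = (P, M, N)` in a topological group `G`
with `N` the union of its compact open subgroups (`IsLimitOfCompactOpen ↥N`), and a short exact
sequence `0 → ρ₁ → ρ₂ → ρ₃ → 0` of smooth representations over a field `k` of characteristic
`0`, the sequence of Jacquet modules `0 → r_P ρ₁ → r_P ρ₂ → r_P ρ₃ → 0` is exact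
(Bernstein–Zelevinsky 1976, Prop. 2.35; Bernstein–Zelevinsky 1977, Prop. 1.9 (a): "If `U` is a
limit of compact subgroups, then `r_{U,θ}` is exact", proved there by reference to [1] = the 1976
paper, Ch. I; Bump 1997, Prop. 4.4.2 for the Borel subgroup of `GL₂`).

## The argument (Bernstein–Zelevinsky 1977, Prop. 1.9 (a); Bump 1997, Prop. 4.4.1–4.4.2)

* Right exactness `r_P ρ₁ → r_P ρ₂ → r_P ρ₃ → 0` is formal for coinvariants and holds over any
  commutative ring without any topology (`jacquetMap_surjective`, `jacquetMap_exact`): the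
  generators `ρ₃(n) w - w` of `V₃(N)` lift along the surjection `g`.
* Injectivity of `r_P ρ₁ → r_P ρ₂` (`jacquetMap_injective`) is the content.  The sources average
  over a compact open subgroup with Haar measure; here the integral is replaced by the finite sum
  it equals on smooth vectors, so no measure theory is needed.  If `f v ∈ V₂(N)`, write
  `f v = ∑ᵢ cᵢ • (ρ₂(nᵢ) wᵢ - wᵢ)`; by `IsLimitOfCompactOpen` the finitely many `nᵢ` lie in a
  compact open subgroup `N₀ ≤ N`.  By smoothness of `ρ₂` the common stabiliser `U` of the `wᵢ` in
  `N₀` is open, hence of finite index (`Subgroup.quotient_finite_of_isOpen`), and its normal core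
  `S ⊴ N₀` still has finite index.  The finite averaging operator `A = ∑_{q ∈ N₀/S} ρ(q̃)` (any
  representatives `q̃`) kills every `ρ₂(nᵢ) wᵢ - wᵢ` (right translation by `nᵢ` permutes
  `N₀/S`, `sum_quotient_out_hom_apply_apply`), commutes with `f`, so `f (A v) = A (f v) = 0` and
  `A v = 0` by injectivity of `f`; finally `|N₀/S| • v = ∑_q (v - ρ₁(q̃) v) ∈ V₁(N)` and
  `|N₀/S| ≠ 0` in `k` (characteristic `0`), so `v ∈ V₁(N)`.  Only the smoothness of `ρ₂` is
  used; those of `ρ₁, ρ₃` (hypotheses of the named fact) are not.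

## References

* I. N. Bernstein, A. V. Zelevinsky, *Representations of the group `GL(n, F)` where `F` is a
  non-archimedean local field*, Russian Math. Surveys 31:3 (1976), 1–68, Prop. 2.35
  (doi:10.1070/rm1976v031n03abeh001532; not held at the time of writing, locator as recorded on
  the vendored fact). [BernsteinZelevinsky1976]
* I. N. Bernstein, A. V. Zelevinsky, *Induced representations of reductive `p`-adic groups I*,
  Ann. Sci. ÉNS (4) 10 (1977), 441–472, 1.9 and Prop. 1.9 (a) (held; statement checked).
  [BernsteinZelevinsky1977]
* D. Bump, *Automorphic forms and representations*, Cambridge Stud. Adv. Math. 55 (1997),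
  Prop. 4.4.1 and Prop. 4.4.2 (held; pp. 460–461 of the held copy). [Bump1997]
-/

open scoped BigOperators

namespace Representation

open Literature.NumberTheory.Automorphic

/-! ### Right exactness (any commutative ring, any group) -/

section RightExact

variable {k G V₁ V₂ V₃ : Type*} [CommRing k] [Group G]
  [AddCommGroup V₁] [Module k V₁] [AddCommGroup V₂] [Module k V₂]
  [AddCommGroup V₃] [Module k V₃]
  {ρ₁ : Representation k G V₁} {ρ₂ : Representation k G V₂} {ρ₃ : Representation k G V₃}

/-- A surjective intertwining map `g : ρ₂ → ρ₃` induces a surjection `r_P ρ₂ → r_P ρ₃` of Jacquet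
modules. (Bernstein–Zelevinsky 1976, Prop. 2.35; Bump 1997, Prop. 4.4.2.)
[cite: BernsteinZelevinsky1976, Prop. 2.35] -/
theorem jacquetMap_surjective (t : ParabolicTriple G) (g : ρ₂.IntertwiningMap ρ₃)
    (hg : Function.Surjective g) : Function.Surjective (jacquetMap t g) := by
  intro y
  obtain ⟨w, rfl⟩ := Coinvariants.mk_surjective _ y
  obtain ⟨v, rfl⟩ := hg w
  exact ⟨Coinvariants.mk _ v, rfl⟩

/-- For a surjective intertwining map `g : ρ₂ → ρ₃`, the kernel `V₃(N)` of `V₃ → (V₃)_N` is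
contained in (indeed equal to) the image of `V₂(N)`: a generator `ρ₃(n) w - w` lifts to
`ρ₂(n) u - u` with `g u = w`. [folklore] -/
theorem Coinvariants.ker_restrict_le_map (t : ParabolicTriple G) (g : ρ₂.IntertwiningMap ρ₃)
    (hg : Function.Surjective g) :
    Coinvariants.ker (t.restrict ρ₃) ≤ (Coinvariants.ker (t.restrict ρ₂)).map g.toLinearMap := by
  refine Submodule.span_le.2 ?_
  rintro _ ⟨⟨n, w⟩, rfl⟩
  obtain ⟨u, rfl⟩ := hg w
  refine ⟨(t.restrict ρ₂) n u - u, Coinvariants.sub_mem_ker n u, ?_⟩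
  change g (ρ₂ ((n : t.P) : G) u - u) = ρ₃ ((n : t.P) : G) (g u) - g u
  rw [map_sub, g.isIntertwining _ _ _ _]

/-- Exactness in the middle: for `ρ₁ → ρ₂ → ρ₃` exact at `ρ₂` with `ρ₂ → ρ₃` surjective, the
sequence of Jacquet modules `r_P ρ₁ → r_P ρ₂ → r_P ρ₃` is exact at `r_P ρ₂` (right exactness of
coinvariants). (Bernstein–Zelevinsky 1976, Prop. 2.35; Bump 1997, Prop. 4.4.2.)
[cite: BernsteinZelevinsky1976, Prop. 2.35] -/
theorem jacquetMap_exact (t : ParabolicTriple G) (f : ρ₁.IntertwiningMap ρ₂)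
    (g : ρ₂.IntertwiningMap ρ₃) (hfg : Function.Exact f g) (hg : Function.Surjective g) :
    Function.Exact (jacquetMap t f) (jacquetMap t g) := by
  intro y
  constructor
  · intro hy
    obtain ⟨v, rfl⟩ := Coinvariants.mk_surjective _ y
    rw [jacquetMap_mk, Coinvariants.mk_eq_zero] at hy
    obtain ⟨y', hy', hgy'⟩ := Coinvariants.ker_restrict_le_map t g hg hy
    have h0 : g (v - y') = 0 := by
      rw [map_sub, sub_eq_zero]
      exact hgy'.symm
    obtain ⟨u, hu⟩ := (hfg _).1 h0
    refine ⟨Coinvariants.mk _ u, ?_⟩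
    rw [jacquetMap_mk, hu, map_sub, (Coinvariants.mk_eq_zero _).2 hy', sub_zero]
  · rintro ⟨x, rfl⟩
    obtain ⟨u, rfl⟩ := Coinvariants.mk_surjective _ x
    rw [jacquetMap_mk, jacquetMap_mk, hfg.apply_apply_eq_zero, map_zero]

end RightExact

/-! ### Left exactness (smooth `ρ₂`, characteristic `0`, `N` a union of compact open subgroups) -/

section LeftExact

/-- **Finite averaging is invariant under right translation.**  Let `ρ` be a representation of
`G`, `φ : H →* G`, `S ⊴ H` of finite index and `w` a vector fixed by `φ(S)`.  Then for `m ∈ H`,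
`∑_{q ∈ H/S} ρ(φ q̃) ρ(φ m) w = ∑_{q ∈ H/S} ρ(φ q̃) w` for any choice of representatives `q̃`
(here `Quotient.out`): right multiplication by `m` permutes `H/S`, and changing a representative
by an element of `S` does not change `ρ(φ ·) w`.  This is the finite form of the Haar-measure
computation `∫_{N₀} ρ(n nᵢ) w dn = ∫_{N₀} ρ(n) w dn` of the sources (the change of variables in
the proof of Bump 1997, Prop. 4.4.1). [folklore] -/
theorem sum_quotient_out_hom_apply_apply {k G H V : Type*} [CommRing k] [Group G] [Group H]
    [AddCommGroup V] [Module k V] (ρ : Representation k G V) (φ : H →* G) (S : Subgroup H)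
    [S.Normal] [Fintype (H ⧸ S)] {w : V} (hS : ∀ s ∈ S, ρ (φ s) w = w) (m : H) :
    ∑ q : H ⧸ S, ρ (φ q.out) (ρ (φ m) w) = ∑ q : H ⧸ S, ρ (φ q.out) w := by
  have key : ∀ q : H ⧸ S,
      ρ (φ q.out) (ρ (φ m) w) = ρ (φ (q * (QuotientGroup.mk m : H ⧸ S)).out) w := by
    intro q
    obtain ⟨s, hs⟩ := QuotientGroup.mk_out_eq_mul S (q.out * m)
    have hq : (QuotientGroup.mk (q.out * m) : H ⧸ S) = q * QuotientGroup.mk m := by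
      rw [QuotientGroup.mk_mul, QuotientGroup.out_eq']
    rw [← hq, hs, map_mul, map_mul, map_mul, map_mul, Module.End.mul_apply,
      Module.End.mul_apply, hS s s.2]
  simp_rw [key]
  exact Fintype.sum_equiv (Equiv.mulRight (QuotientGroup.mk m : H ⧸ S)) _ _ fun _ => rfl

variable {k G V₁ V₂ : Type*} [Field k] [CharZero k] [Group G] [TopologicalSpace G]
  [IsTopologicalGroup G] [AddCommGroup V₁] [Module k V₁] [AddCommGroup V₂] [Module k V₂]
  {ρ₁ : Representation k G V₁} {ρ₂ : Representation k G V₂}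

/-- **Left exactness of the Jacquet functor** (Bernstein–Zelevinsky 1976, Prop. 2.35; 1977,
Prop. 1.9 (a)): over a field of characteristic `0`, if `N` is the union of its compact open
subgroups and `ρ₂` is smooth, an injective intertwining map `f : ρ₁ → ρ₂` induces an injection
`r_P ρ₁ → r_P ρ₂`, i.e. `V₁(N) = V₁ ∩ V₂(N)`.  Proof by finite averaging over `N₀ / S` for a
compact open `N₀ ≤ N` containing the group elements of a presentation of `f v ∈ V₂(N)` and the
normal core `S` of the common stabiliser of its vectors (see the module docstring).
[cite: BernsteinZelevinsky1976, Prop. 2.35] -/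
theorem jacquetMap_injective (t : ParabolicTriple G) (hN : IsLimitOfCompactOpen t.N)
    (h₂ : ρ₂.IsSmooth) (f : ρ₁.IntertwiningMap ρ₂) (hf : Function.Injective f) :
    Function.Injective (jacquetMap t f) := by
  classical
  rw [injective_iff_map_eq_zero]
  intro x hx
  obtain ⟨v, rfl⟩ := Coinvariants.mk_surjective _ x
  rw [jacquetMap_mk, Coinvariants.mk_eq_zero] at hx
  rw [Coinvariants.mk_eq_zero]
  obtain ⟨c, hc⟩ := Finsupp.mem_span_range_iff_exists_finsupp.1 hx
  -- Step 1: a compact open subgroup `N₀ ≤ N` containing the group elements of the presentation.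
  let toN : ↥(t.N.subgroupOf t.P) → ↥t.N :=
    fun n => ⟨((n : t.P) : G), Subgroup.mem_subgroupOf.1 n.2⟩
  obtain ⟨N₀, -, hN₀c, hsub⟩ :=
    hN _ (c.support.image fun p => toN p.1).finite_toSet.isCompact
  haveI : CompactSpace N₀ := isCompact_iff_compactSpace.1 hN₀c
  let φ : N₀ →* G := t.N.subtype.comp N₀.subtype
  have hφ : Continuous φ := continuous_subtype_val.comp continuous_subtype_val
  -- Step 2: a normal subgroup `S` of finite index in `N₀` fixing the vectors of the presentation.
  let U : Subgroup N₀ := ⨅ p : c.support, (ρ₂.stabilizerSubgroup p.1.2).comap φ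
  have hUo : IsOpen (U : Set N₀) := by
    simp only [U, Subgroup.coe_iInf]
    exact isOpen_iInter_of_finite fun p => (h₂ p.1.2).preimage hφ
  haveI : U.FiniteIndex :=
    @Subgroup.finiteIndex_of_finite_quotient _ _ U (Subgroup.quotient_finite_of_isOpen U hUo)
  let S : Subgroup N₀ := U.normalCore
  haveI : Fintype (N₀ ⧸ S) := Fintype.ofFinite _
  have hS : ∀ p ∈ c.support, ∀ s ∈ S, ρ₂ (φ s) p.2 = p.2 := by
    intro p hp s hs
    have h := (Subgroup.mem_iInf.1 (U.normalCore_le hs)) ⟨p, hp⟩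
    simpa only [Subgroup.mem_comap, mem_stabilizerSubgroup] using h
  -- Step 3: the finite averaging operator over `N₀ / S` kills `f v`.
  let A : V₂ →ₗ[k] V₂ := ∑ q : N₀ ⧸ S, ρ₂ (φ q.out)
  have hA : ∀ p ∈ c.support, A ((t.restrict ρ₂) p.1 p.2 - p.2) = 0 := by
    intro p hp
    have hmem : toN p.1 ∈ N₀ := hsub (Finset.mem_coe.2 (Finset.mem_image_of_mem _ hp))
    have hp1 : (t.restrict ρ₂) p.1 p.2 = ρ₂ (φ ⟨toN p.1, hmem⟩) p.2 := rfl
    rw [map_sub, hp1, LinearMap.sum_apply, LinearMap.sum_apply, sub_eq_zero]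
    exact sum_quotient_out_hom_apply_apply ρ₂ φ S (hS p hp) _
  have hAfv : A (f v) = 0 := by
    rw [← hc, map_finsuppSum]
    refine Finset.sum_eq_zero fun p hp => ?_
    dsimp only
    rw [map_smul, hA p hp, smul_zero]
  -- Step 4: hence it kills `v`, by injectivity of `f`.
  have hsum : ∑ q : N₀ ⧸ S, ρ₁ (φ q.out) v = 0 := by
    apply hf
    rw [map_sum, map_zero, ← hAfv, LinearMap.sum_apply]
    exact Finset.sum_congr rfl fun q _ => f.isIntertwining _ _ _ _
  -- Step 5: `|N₀ / S| • v = ∑_q (v - ρ₁(q̃) v) ∈ V₁(N)` and `|N₀ / S| ≠ 0` in `k`.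
  have hmem : ((Fintype.card (N₀ ⧸ S) : ℕ) : k) • v ∈ Coinvariants.ker (t.restrict ρ₁) := by
    have hv : ((Fintype.card (N₀ ⧸ S) : ℕ) : k) • v = ∑ q : N₀ ⧸ S, (v - ρ₁ (φ q.out) v) := by
      rw [Finset.sum_sub_distrib, hsum, sub_zero, Finset.sum_const, Finset.card_univ,
        Nat.cast_smul_eq_nsmul]
    rw [hv]
    refine Submodule.sum_mem _ fun q _ => ?_
    have hq : φ q.out ∈ t.N := (q.out : t.N).2
    let n : ↥(t.N.subgroupOf t.P) := ⟨⟨φ q.out, t.N_le hq⟩, Subgroup.mem_subgroupOf.2 hq⟩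
    have hn : v - ρ₁ (φ q.out) v = -((t.restrict ρ₁) n v - v) := (neg_sub _ _).symm
    rw [hn]
    exact Submodule.neg_mem _ (Coinvariants.sub_mem_ker n v)
  have hne : ((Fintype.card (N₀ ⧸ S) : ℕ) : k) ≠ 0 := Nat.cast_ne_zero.2 Fintype.card_ne_zero
  exact (Submodule.smul_mem_iff _ hne).1 hmem

end LeftExact

/-! ### The discharge -/

section Discharge

variable {k G : Type*} [Field k] [CharZero k] [Group G] [TopologicalSpace G] [IsTopologicalGroup G]

/-- **Exactness of the Jacquet functor** (discharge of the named fact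
`Representation.jacquet_exact`): for `k` a field of characteristic `0`, `t = (P, M, N)` a
parabolic triple in a topological group `G` with `N` the union of its compact open subgroups, and
a short exact sequence `0 → ρ₁ → ρ₂ → ρ₃ → 0` of smooth `G`-representations, the sequence
`0 → r_P ρ₁ → r_P ρ₂ → r_P ρ₃ → 0` of Jacquet modules is exact.
(Bernstein–Zelevinsky 1976, Prop. 2.35; Bernstein–Zelevinsky 1977, Prop. 1.9 (a); Bump 1997,
Prop. 4.4.2.) [cite: BernsteinZelevinsky1976, Prop. 2.35] -/
theorem jacquet_exact_holds : jacquet_exact (k := k) (G := G) := by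
  intro V₁ V₂ V₃ _ _ _ _ _ _ ρ₁ ρ₂ ρ₃ t hN _ h₂ _ f g hf hfg hg
  exact ⟨jacquetMap_injective t hN h₂ f hf, jacquetMap_exact t f g hfg hg,
    jacquetMap_surjective t g hg⟩

end Discharge

end Representation
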